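import Summits.CriticalPhenomena.PercolationContinuityZ3.Theorems.PercNearOneGluingNoHeavyLowerTailSahiSlotPatternSaturation
import Summits.CriticalPhenomena.PercolationContinuityZ3.Theorems.PercNearOneGluingNoHeavyLowerTailSahiSlotPatternSignMinus
import Summits.CriticalPhenomena.PercolationContinuityZ3.Theorems.PercNearOneGluingNoHeavyLowerTailSahiSlotPatternThree

/-!
# Coloured antichains: the finite normal form of every slot-pattern cell, and the cell `(3,4)` reduced to one finite check

Support file (cell `prim-sahi`, seat `prim-sahi-typer` gen 27; `--supports stmt-CriticalPhenomena-4575`).  Pure proofs, no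
definitions, no `sorry`.

Continuation of `…SahiSlotPatternSaturation`.  A saturated family of up-sets `V_0, …, V_n` of the slot cube `Q = [n+1]^d` is recovered from the
set `N` of its maximal non-elements and the colouring `c : N → Fin (n+1)` (`p ↦` the unique member missing `p`):
`V_i = {q | ∀ p ∈ N, c p = i → ¬ q ≤ p}`, and `N` is an antichain.  Hence (`slotPatternPos_of_colouring`): under the head-slot sign law, the cell
`SlotPatternPos d (n+1)` follows from
  `∀ N ⊆ Q antichain, ∀ c : Q → Fin (n+1), 0 ≤ patternForm d (n+1) (i ↦ 1_{ {q | ∀ p ∈ N, c p = i → ¬ q ≤ p} })`      (★)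
— a check over `Σ_N (n+1)^{|N|}` families.  With P3's sign law (`patternForm_single_nonpos`, …SahiSlotPatternSignMinus) the hypothesis becomes
"the lower cells `SlotPatternPos d k`, `k ≤ n`" (`slotPatternPos_of_colouring'`), and at `(3,4)` the lower cells `(3,1), (3,2), (3,3)` are
theorems, so **`SlotPatternPos 3 4`, prim-sahi's `PatternPosN 4 3` and Lieb–Sahi's `LiebSahiContinuum 3 4` all follow from the single finite
statement (★) on `[4]^3`** (`slotPatternPos_three_four_of_colouring`, `patternPosN_four_three_of_colouring`,
`liebSahiContinuum_three_four_of_colouring`) — `4 424 940 417` families, checked exhaustively OUTSIDE the kernel by two independent exact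
engines (typer gen 27, kit j165842–j165845 and j165846–j165853: 0 negatives, `Φ ≥ 576` unless a member is the whole cube).  Nothing in this
file asserts (★); the `(3,4)` declarations are implications. [this work]
-/

namespace Summit.CriticalPhenomena.PercolationContinuityZ3.Theorems

open Finset Function Equiv
open Literature.Combinatorics.Sahi2008

namespace SahiSlot

section Colouring

open scoped Classical

variable {d n : ℕ}

/-- The members cut out by a coloured point set are up-sets: `{q | ∀ p ∈ N, c p = i → ¬ q ≤ p}`. [this work] -/
theorem isUpperSet_colourMember {m k : ℕ} (N : Finset (Q d m)) (c : Q d m → Fin k) (i : Fin k) :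
    IsUpperSet ((univ.filter fun q : Q d m => ∀ p ∈ N, c p = i → ¬ q ≤ p : Finset (Q d m)) : Set (Q d m)) := by
  intro a b hab ha
  rw [mem_coe, mem_filter] at ha ⊢
  exact ⟨mem_univ _, fun p hp hpi hbp => ha.2 p hp hpi (hab.trans hbp)⟩

/-- In a saturated family the member missing a maximal non-element is unique. [this work] -/
theorem saturated_index_unique (V : Fin (n + 1) → Finset (Q d (n + 1)))
    (hsat : ∀ i j, i ≠ j → ∀ y, y ∉ V i → (∀ z, y < z → z ∈ V i) → y ∈ V j)
    {p : Q d (n + 1)} {i i' : Fin (n + 1)} (hi : p ∉ V i) (himax : ∀ z, p < z → z ∈ V i) (hi' : p ∉ V i') : i = i' := by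
  by_contra hne
  exact hi' (hsat i i' hne p hi himax)

/-- Above every non-element of a finset of the slot cube lies a MAXIMAL non-element. [this work] -/
theorem exists_maximal_notMem_ge {m : ℕ} (W : Finset (Q d m)) {q : Q d m} (hq : q ∉ W) :
    ∃ p, q ≤ p ∧ p ∉ W ∧ ∀ z, p < z → z ∈ W := by
  set S : Finset (Q d m) := univ.filter fun p => q ≤ p ∧ p ∉ W with hS
  have hqS : q ∈ S := by rw [hS, mem_filter]; exact ⟨mem_univ _, le_rfl, hq⟩
  obtain ⟨p, hpmax⟩ := S.exists_maximal ⟨q, hqS⟩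
  have hpS : p ∈ S := hpmax.1
  rw [hS, mem_filter] at hpS
  refine ⟨p, hpS.2.1, hpS.2.2, fun z hz => ?_⟩
  by_contra hzW
  have hzS : z ∈ S := by rw [hS, mem_filter]; exact ⟨mem_univ _, hpS.2.1.trans (le_of_lt hz), hzW⟩
  exact absurd (hpmax.2 hzS (le_of_lt hz)) (not_le_of_gt hz)

/-- **COLOURED ANTICHAINS.**  Under the head-slot sign law, `SlotPatternPos d (n+1)` follows from the nonnegativity of the pattern
functional on the families `V_i = {q | ∀ p ∈ N, c p = i → ¬ q ≤ p}` for antichains `N` of the slot cube and colourings `c` — the finite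
normal form (★) of the cell. [this work] -/
theorem slotPatternPos_of_colouring
    (hsign : ∀ (y : Q d (n + 1)) (F : Fin n → Finset (Q d (n + 1))), (∀ j, IsUpperSet (F j : Set (Q d (n + 1)))) →
      ∀ j₀, y ∉ F j₀ → patternForm d (n + 1) (Fin.cons (setInd {y}) (fun j => setInd (F j))) ≤ 0)
    (h : ∀ (N : Finset (Q d (n + 1))) (c : Q d (n + 1) → Fin (n + 1)), IsAntichain (· ≤ ·) (N : Set (Q d (n + 1))) →
      0 ≤ patternForm d (n + 1)
        (fun i => setInd (univ.filter fun q : Q d (n + 1) => ∀ p ∈ N, c p = i → ¬ q ≤ p))) :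
    SlotPatternPos d (n + 1) := by
  classical
  refine slotPatternPos_of_saturated hsign fun V hV hsat => ?_
  -- the maximal non-elements and their (unique) colours
  set N : Finset (Q d (n + 1)) := univ.filter fun p => ∃ i, p ∉ V i ∧ ∀ z, p < z → z ∈ V i with hN
  have hc : ∀ p : Q d (n + 1), ∃ i : Fin (n + 1), (p ∈ N → p ∉ V i ∧ ∀ z, p < z → z ∈ V i) := by
    intro p
    by_cases hp : p ∈ N
    · rw [hN, mem_filter] at hp
      obtain ⟨i, hi⟩ := hp.2
      exact ⟨i, fun _ => hi⟩
    · exact ⟨0, fun h' => (hp h').elim⟩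
  choose c hcspec using hc
  -- the coloured family IS `V`
  have hVeq : (fun i => setInd (univ.filter fun q : Q d (n + 1) => ∀ p ∈ N, c p = i → ¬ q ≤ p)) = fun i => setInd (V i) := by
    funext i
    congr 1
    ext q
    rw [mem_filter]
    constructor
    · rintro ⟨-, hq⟩
      by_contra hqV
      obtain ⟨p, hqp, hpV, hpmax⟩ := exists_maximal_notMem_ge (V i) hqV
      have hpN : p ∈ N := by rw [hN, mem_filter]; exact ⟨mem_univ _, i, hpV, hpmax⟩
      have hci : c p = i := saturated_index_unique V hsat (hcspec p hpN).1 (hcspec p hpN).2 hpV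
      exact hq p hpN hci hqp
    · intro hq
      refine ⟨mem_univ _, fun p hpN hpi hqp => ?_⟩
      have hpV : p ∉ V (c p) := (hcspec p hpN).1
      rw [hpi] at hpV
      exact hpV (hV i hqp hq)
  -- `N` is an antichain
  have hanti : IsAntichain (· ≤ ·) (N : Set (Q d (n + 1))) := by
    intro p hp p' hp' hne hle
    rw [mem_coe] at hp hp'
    have h1 := hcspec p hp
    have h2 := hcspec p' hp'
    have hlt : p < p' := lt_of_le_of_ne hle hne
    by_cases hcc : c p = c p'
    · -- same colour: `p'` is a larger non-element of `V (c p)`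
      have : p' ∈ V (c p) := h1.2 p' hlt
      rw [hcc] at this
      exact h2.1 this
    · -- different colours: `p ∈ V (c p')` by saturation, hence `p' ∈ V (c p')`
      have hpV : p ∈ V (c p') := hsat (c p) (c p') hcc p h1.1 h1.2
      exact h2.1 (hV (c p') hle hpV)
  have := h N c hanti
  rwa [hVeq] at this

/-- The same with P3's sign law fed in: **every cell `(d, n+1)` reduces, given the lower cells `SlotPatternPos d k` (`1 ≤ k ≤ n`), to the finite
check (★) over coloured antichains of `[n+1]^d`.** [this work] -/
theorem slotPatternPos_of_colouring' (hP : ∀ k, 1 ≤ k → k ≤ n → SlotPatternPos d k)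
    (h : ∀ (N : Finset (Q d (n + 1))) (c : Q d (n + 1) → Fin (n + 1)), IsAntichain (· ≤ ·) (N : Set (Q d (n + 1))) →
      0 ≤ patternForm d (n + 1)
        (fun i => setInd (univ.filter fun q : Q d (n + 1) => ∀ p ∈ N, c p = i → ¬ q ≤ p))) :
    SlotPatternPos d (n + 1) :=
  slotPatternPos_of_colouring (fun y F hF j₀ hy => patternForm_single_nonpos hP y F hF j₀ hy) h

/-- Likewise for the saturated form: given the lower cells, `SlotPatternPos d (n+1)` follows from `Φ ≥ 0` on saturated families. [this work] -/
theorem slotPatternPos_of_saturated' (hP : ∀ k, 1 ≤ k → k ≤ n → SlotPatternPos d k)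
    (hsat : ∀ V : Fin (n + 1) → Finset (Q d (n + 1)), (∀ i, IsUpperSet (V i : Set (Q d (n + 1)))) →
      (∀ i j, i ≠ j → ∀ y, y ∉ V i → (∀ z, y < z → z ∈ V i) → y ∈ V j) → 0 ≤ patternForm d (n + 1) (fun i => setInd (V i))) :
    SlotPatternPos d (n + 1) :=
  slotPatternPos_of_saturated (fun y F hF j₀ hy => patternForm_single_nonpos hP y F hF j₀ hy) hsat

/-! ### The cell `(3,4)`: one finite statement on `[4]^3` -/

/-- The lower cells of `(3,4)` are theorems: `(3,1)`, `(3,2)` (every `d`) and `(3,3)` (prim-sahi's `[3]^3` certificate / `slotPatternPos_three_three`). [this work] -/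
theorem slotPatternPos_three_of_le_three' (k : ℕ) (hk1 : 1 ≤ k) (hk3 : k ≤ 3) : SlotPatternPos 3 k := by
  interval_cases k
  · exact slotPatternPos_one 3
  · exact slotPatternPos_two 3
  · exact slotPatternPos_three_three

/-- **`(3,4)` FROM ONE FINITE CHECK**: `SlotPatternPos 3 4` (coefficientwise Lieb–Sahi on `[4]^3` at order 4) follows from the nonnegativity of
`patternForm 3 4` on the `4 424 940 417` coloured antichains of `[4]^3` (verified outside the kernel by two independent exact engines, typer gen 27;
NOT asserted here). [this work] -/
theorem slotPatternPos_three_four_of_colouring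
    (h : ∀ (N : Finset (Q 3 4)) (c : Q 3 4 → Fin 4), IsAntichain (· ≤ ·) (N : Set (Q 3 4)) →
      0 ≤ patternForm 3 4 (fun i => setInd (univ.filter fun q : Q 3 4 => ∀ p ∈ N, c p = i → ¬ q ≤ p))) :
    SlotPatternPos 3 4 :=
  slotPatternPos_of_colouring' slotPatternPos_three_of_le_three' h

/-- The saturated form at `(3,4)`. [this work] -/
theorem slotPatternPos_three_four_of_saturated
    (hsat : ∀ V : Fin 4 → Finset (Q 3 4), (∀ i, IsUpperSet (V i : Set (Q 3 4))) →
      (∀ i j, i ≠ j → ∀ y, y ∉ V i → (∀ z, y < z → z ∈ V i) → y ∈ V j) → 0 ≤ patternForm 3 4 (fun i => setInd (V i))) :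
    SlotPatternPos 3 4 :=
  slotPatternPos_of_saturated' slotPatternPos_three_of_le_three' hsat

/-- **prim-sahi's `PatternPosN 4 3` from the finite check (★) on `[4]^3`** (through P3's identification `patternPosN_iff_slotPatternPos`). [this work] -/
theorem patternPosN_four_three_of_colouring
    (h : ∀ (N : Finset (Q 3 4)) (c : Q 3 4 → Fin 4), IsAntichain (· ≤ ·) (N : Set (Q 3 4)) →
      0 ≤ patternForm 3 4 (fun i => setInd (univ.filter fun q : Q 3 4 => ∀ p ∈ N, c p = i → ¬ q ≤ p))) :
    SahiGridPatternN.PatternPosN 4 3 :=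
  patternPosN_iff_slotPatternPos.2 (slotPatternPos_three_four_of_colouring h)

/-- **Lieb–Sahi's Conjecture 1.1 on `[0,1]^3` at order 4 from the finite check (★) on `[4]^3`.** [this work] -/
theorem liebSahiContinuum_three_four_of_colouring
    (h : ∀ (N : Finset (Q 3 4)) (c : Q 3 4 → Fin 4), IsAntichain (· ≤ ·) (N : Set (Q 3 4)) →
      0 ≤ patternForm 3 4 (fun i => setInd (univ.filter fun q : Q 3 4 => ∀ p ∈ N, c p = i → ¬ q ≤ p))) :
    LiebSahiContinuum 3 4 :=
  liebSahiContinuum_of_slotPatternPos (slotPatternPos_three_four_of_colouring h)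

end Colouring

end SahiSlot

end Summit.CriticalPhenomena.PercolationContinuityZ3.Theorems
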